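import Literature.MathematicalPhysics.QuantumFieldTheory.Balaban1983to89.B9Eq325RLipschitzSqrtTowerDiagonal

/-!
# `Balaban1983to89.B9Eq325RLipschitzSqrtTowerLinear` — T. Bałaban, *Propagators for lattice gauge theories in a background field*, Commun. Math.
# Phys. **99** (1985) 389–434 [Balaban1985BackgroundPropagators] p. 403 with (3.25) p. 394, (3.35)–(3.37) p. 396, (3.16) p. 393, Thm 3.11 p. 416:
# **THE `k`-LEVEL `R`-LETTER ON PRINT's DIAGONAL, α-LINEAR — `‖R_k(U)f − R_k(1)f‖ ≤ C_R·α·‖f‖` with `C_R = 3s_A∕s♯` a CLOSED function of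
# `(d, a′, M_φM_φ′, L, r, α₀)`, under the geometric level profile `ε_j ≤ α·r^j` and `α ≤ α₀`** — the LITERAL inhabitant of the `hR` slot of the NE9
# owner's `B9Thm311SmallFieldCoercivityTowerDiagonal.strong_coercive_tower_diagonal`; this lineage's `B9Eq325RLipschitzSqrtTowerDiagonal` §3 read through
# the monotonicity of its closed letters

statement-level skeleton of published theorems with citation tags; proofs where landed; nothing here is a claim about the Yang–Mills mass gap

PDF held: `paper:balaban1985-cmp99-background-propagators` (journal page = PDF page + 388), pp. 393–396, 403, 416 — through the verbatim quotations of the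
supplier files of `B9Eq325RLipschitzSqrtTowerDiagonal`.

CITATION HEADER (lean-in-tree rule 2026-08-18).  Audit cell `pub-balaban`, sub-cell `t4`, NE9 crux team (2): LEAF PROVER 04
(`b2b-balaban-t4-ne9-formalise-leaf-04` gen 75), INTENT-5.  Route R2′ STEP B7′ sub-step S3 in the tower currency (the owner's «ROUTE G ONE STOREY UP»,
journal l.47319): the owner's INTENT-4 `strong_coercive_tower_diagonal` displays `hR : ∀ y, ‖R_k(U)y − R_k(1)y‖ ≤ C_R·α·‖y‖` under the fine-bond window
`‖U(b) − 1‖ ≤ αη` and the level profile `ε_j ≤ α·r^j`; THIS FILE produces exactly that shape from `B9Eq325RLipschitzSqrtTowerDiagonal.norm_RofUk_sub_RofUk_one_le_diagonal`.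

THE PRINT (verbatim, as quoted by the suppliers).  p. 403 l. 27–28: *«These results imply that the operators R(U), P(U) = I − R(U) extend analytically
to the domain (3.37) and satisfy the same bounds»*; (3.35)–(3.37) p. 396: the η-scaled small-field class and its analytic extension.

WHAT IS PROVED (sorry-free; 0 `def`; [folklore] real arithmetic on the closed letters of `B9Eq325RLipschitzSqrtTowerDiagonal` §3; nothing of [B9] asserted).
* private `geom_sum_le_inv`, `prod_one_add_le_exp_sum`, `exp_sub_one_le_two_mul`; **`prod_profile_sub_one_le_linear`** (`Π_{j≤n}(1 + Kε_j)^{d(L−1)} − 1 ≤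
  2·(d(L−1)K∕(1−r))·α` for `ε_j ≤ αr^j` (`j ≤ n`), `0 ≤ r < 1`, `d(L−1)Kα∕(1−r) ≤ 1` — FREE OF THE NUMBER OF LEVELS).
* **`norm_RofUk_sub_RofUk_one_le_diagonal_linear`** — on the diagonal `ηL^{n+1} = 1`, `c₀(L^{n+1})^d = c₁`, for fine bonds `U(b) ∈ U1`, `‖U(b) − 1‖ ≤ αη`,
  `hRS`, level averages `Ū^j(b) ∈ U1`, `‖Ū^j(b) − 1‖ ≤ ε_j ≤ α·r^j`, `α ≤ α₀`, with slopes and floors AT `α₀` bound by definitional equalities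
  (`s_D = √d·2M_φM_φ′`, `s_Q = 2·d(L−1)·2M_φM_φ′∕(1−r)`, `θ̄ = s_Qα₀`, `γ_m = 1∕(2+2∕a′) − (s_Dα₀ + (s_Dα₀)² + a′θ̄(2+θ̄))`,
  `s_G = 2s_Dγ_m⁻¹(√γ_m)⁻¹ + |a′|s_Q(2+θ̄)γ_m⁻²`, `s_A = s_G(1+θ̄) + (2+2∕a′)s_Q`, `s♯ = √((12d(6∕5)^{d−1} + a′)^{−2})`) in the window
  `d(L−1)·2M_φM_φ′·α₀∕(1−r) ≤ 1`, `0 < γ_m`, `2s_Aα₀ ≤ s♯`:  **`‖R_k(U)f − R_k(1)f‖ ≤ (3s_A∕s♯)·α·‖f‖`**.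
MODEL ∕ DECLARED READINGS.  As `B9Eq325RLipschitzSqrtTowerDiagonal`; the windows are DISPLAYED (print's running small-field axioms); `C_R` depends on the
block size `L` (through `s_Q`) as print's constants do, NOT on `η`, the volume or the number of levels.
HONEST SCOPE.  [folklore] monotonicity bookkeeping; ONE route sub-step's letter in the consumer's currency; «NE9 ⇐ the named binders»; NE9 NOT PRINTED ∕
NOT PROVED; NOT summit progress (cell pub-balaban: row NE9 WALLED ON A MODEL; spine PROVED 0∕9; rung (B)+1 on a finite T⁴ — NOT infinite volume, NOT
mass gap, NOT BetaPertH, NOT Clay).  NEW file importing `B9Eq325RLipschitzSqrtTowerDiagonal` only; nothing modified.  Net new unproved facts: 0.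
-/

noncomputable section

open scoped InnerProductSpace ComplexConjugate BigOperators

namespace Literature.MathematicalPhysics.QuantumFieldTheory.Balaban1983to89.B9Eq325RLipschitzSqrtTowerLinear

open B4Sect5Torus (TSite)
open B9SectCLatticeCarrier (Bond)
open B9Eq311L2Pairing (WL2)
open B7Prop1Explicit (U1)
open B11Eq103H1Complex (SiteL2K)
open B9Eq310HessianOperator (adTransportW)
open B9Eq315QTower (towerP UlevOf)
open B9Eq326OperatorTower (QprimeTowerW RofUk)
open B9Eq325RLipschitzSqrtTowerDiagonal (norm_RofUk_sub_RofUk_one_le_diagonal)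

variable {d : ℕ} (L : ℕ) [NeZero L] (m : Fin d → ℕ) [∀ i, NeZero (m i)] (n : ℕ)
  {𝔸 : Type*} [NormedRing 𝔸] [NormedAlgebra ℂ 𝔸] [CompleteSpace 𝔸] [NormOneClass 𝔸]
  {W : Type*} [NormedAddCommGroup W] [InnerProductSpace ℂ W] [FiniteDimensional ℂ W] (φ : W ≃ₗ[ℂ] 𝔸) {Mφ Mφ' : ℝ} (hMφ : 0 ≤ Mφ) (hMφ' : 0 ≤ Mφ')
  (hφ : ∀ w, ‖φ w‖ ≤ Mφ * ‖w‖) (hφ' : ∀ X, ‖φ.symm X‖ ≤ Mφ' * ‖X‖)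
  (c₀ : ℝ) [Fact (0 < c₀)] (η : ℝ) (c₁ : ℝ) [Fact (0 < c₁)] {a' : ℝ} (ha' : 0 < a')
  (hηL : η * (L : ℝ) ^ (n + 1) = 1) (hw : c₀ * ((L : ℝ) ^ (n + 1)) ^ d = c₁)
  (U : Bond d (towerP L m (n + 1)) → 𝔸ˣ)
  (hRS : ∀ (b : Bond d (towerP L m (n + 1))) (v u : W), ⟪adTransportW φ U b v, u⟫_ℂ = ⟪v, adTransportW φ (fun b => (U b)⁻¹) b u⟫_ℂ)
  {α : ℝ} (hα : 0 ≤ α) (hUb : ∀ b, U b ∈ U1 𝔸) (hUε : ∀ b, ‖(U b : 𝔸) - 1‖ ≤ α * η)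

/-! ## §1 Arithmetic: the level-profile product is `O(α)` -/

omit [NeZero L] [∀ i, NeZero (m i)] [CompleteSpace 𝔸] [NormOneClass 𝔸] [FiniteDimensional ℂ W] [Fact (0 < c₀)] [Fact (0 < c₁)] in
/-- `Σ_{j<N} r^j ≤ (1 − r)⁻¹` for `0 ≤ r < 1`. [folklore] -/
private theorem geom_sum_le_inv {r : ℝ} (hr0 : 0 ≤ r) (hr1 : r < 1) (N : ℕ) : ∑ j ∈ Finset.range N, r ^ j ≤ (1 - r)⁻¹ :=
  sum_le_hasSum (Finset.range N) (fun j _ => pow_nonneg hr0 j) (hasSum_geometric_of_lt_one hr0 hr1)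

omit [NeZero L] [∀ i, NeZero (m i)] [CompleteSpace 𝔸] [NormOneClass 𝔸] [FiniteDimensional ℂ W] [Fact (0 < c₀)] [Fact (0 < c₁)] in
/-- `Π_{j<N}(1 + t_j) ≤ exp(Σ_{j<N} t_j)` for `t_j ≥ 0`. [folklore] -/
private theorem prod_one_add_le_exp_sum (t : ℕ → ℝ) (ht : ∀ j, 0 ≤ t j) (N : ℕ) :
    ∏ j ∈ Finset.range N, (1 + t j) ≤ Real.exp (∑ j ∈ Finset.range N, t j) := by
  rw [Real.exp_sum]
  exact Finset.prod_le_prod (fun j _ => by linarith [ht j]) fun j _ => by linarith [Real.add_one_le_exp (t j)]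

omit [NeZero L] [∀ i, NeZero (m i)] [CompleteSpace 𝔸] [NormOneClass 𝔸] [FiniteDimensional ℂ W] [Fact (0 < c₀)] [Fact (0 < c₁)] in
/-- `e^y − 1 ≤ 2y` for `0 ≤ y ≤ 1` (`|e^y − 1 − y| ≤ y²`). [folklore] -/
private theorem exp_sub_one_le_two_mul {y : ℝ} (hy0 : 0 ≤ y) (hy1 : y ≤ 1) : Real.exp y - 1 ≤ 2 * y := by
  have h := Real.abs_exp_sub_one_sub_id_le (x := y) (by rw [abs_of_nonneg hy0]; exact hy1)
  have h1 : Real.exp y - 1 - y ≤ y ^ 2 := (le_abs_self _).trans h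
  have h2 : y ^ 2 ≤ y := by rw [pow_two]; exact mul_le_of_le_one_left hy0 hy1
  linarith

omit [NeZero L] [∀ i, NeZero (m i)] [CompleteSpace 𝔸] [NormOneClass 𝔸] [FiniteDimensional ℂ W] [Fact (0 < c₀)] [Fact (0 < c₁)] in
/-- **THE LEVEL-PROFILE PRODUCT IS `O(α)`, FREE OF THE NUMBER OF LEVELS**: for `ε_j ≤ α·r^j` (`j < n+1`), `0 ≤ r < 1`, `K ≥ 0` and
`d(L−1)·K·α∕(1−r) ≤ 1`: `Π_{j≤n}(1 + Kε_j)^{d(L−1)} − 1 ≤ 2·(d(L−1)·K∕(1−r))·α`. [folklore] [cite: Balaban1985BackgroundPropagators, (3.35)–(3.37) p.396] -/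
theorem prod_profile_sub_one_le_linear {K r α : ℝ} (hK : 0 ≤ K) (hr0 : 0 ≤ r) (hr1 : r < 1) (hα : 0 ≤ α) (εU : ℕ → ℝ)
    (hεU : ∀ j, 0 ≤ εU j) (hεg : ∀ j < n + 1, εU j ≤ α * r ^ j) (hc1 : ((d * (L - 1) : ℕ) : ℝ) * K / (1 - r) * α ≤ 1) :
    (∏ j ∈ Finset.range (n + 1), (1 + K * εU j) ^ (d * (L - 1))) - 1 ≤ 2 * (((d * (L - 1) : ℕ) : ℝ) * K / (1 - r)) * α := by
  have h1r : 0 < 1 - r := by linarith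
  set y : ℝ := ((d * (L - 1) : ℕ) : ℝ) * K / (1 - r) * α with hy
  have hy0 : 0 ≤ y := by rw [hy]; positivity
  -- the product is at most `exp y`
  have hsum : ∑ j ∈ Finset.range (n + 1), K * εU j ≤ K * α * (1 - r)⁻¹ := by
    calc ∑ j ∈ Finset.range (n + 1), K * εU j ≤ ∑ j ∈ Finset.range (n + 1), K * (α * r ^ j) :=
          Finset.sum_le_sum fun j hj => mul_le_mul_of_nonneg_left (hεg j (Finset.mem_range.1 hj)) hK
      _ = K * α * ∑ j ∈ Finset.range (n + 1), r ^ j := by rw [Finset.mul_sum]; refine Finset.sum_congr rfl fun j _ => by ring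
      _ ≤ K * α * (1 - r)⁻¹ := mul_le_mul_of_nonneg_left (geom_sum_le_inv hr0 hr1 _) (by positivity)
  have hP : ∏ j ∈ Finset.range (n + 1), (1 + K * εU j) ^ (d * (L - 1)) ≤ Real.exp y := by
    rw [Finset.prod_pow]
    have h1 : ∏ j ∈ Finset.range (n + 1), (1 + K * εU j) ≤ Real.exp (K * α * (1 - r)⁻¹) :=
      (prod_one_add_le_exp_sum (fun j => K * εU j) (fun j => by have := hεU j; positivity) (n + 1)).trans (Real.exp_le_exp.2 hsum)
    have h0 : 0 ≤ ∏ j ∈ Finset.range (n + 1), (1 + K * εU j) := Finset.prod_nonneg fun j _ => by have := hεU j; positivity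
    calc (∏ j ∈ Finset.range (n + 1), (1 + K * εU j)) ^ (d * (L - 1)) ≤ (Real.exp (K * α * (1 - r)⁻¹)) ^ (d * (L - 1)) :=
          pow_le_pow_left₀ h0 h1 _
      _ = Real.exp y := by rw [← Real.exp_nat_mul, hy]; congr 1; field_simp
  have hy1 : y ≤ 1 := hc1
  linarith [exp_sub_one_le_two_mul hy0 hy1]

/-! ## §2 The `k`-level `R`-letter, α-linear: the literal inhabitant of the owner's `hR` slot -/

include hMφ hMφ' hφ hφ' ha' hηL hw hRS hα hUb hUε in
/-- **THE `k`-LEVEL `R`-LETTER, α-LINEAR — THE LITERAL INHABITANT OF THE OWNER's `hR : ‖(R_k(U) − R_k(1))y‖ ≤ C_R·α·‖y‖`**: on print's diagonal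
(`ηL^{n+1} = 1`, `c₀(L^{n+1})^d = c₁`), for fine bonds `U(b) ∈ U1`, `‖U(b) − 1‖ ≤ αη`, `hRS`, level averages `Ū^j(b) ∈ U1` with the GEOMETRIC profile
`‖Ū^j(b) − 1‖ ≤ ε_j ≤ α·r^j` (`0 ≤ r < 1`; the owner's INTENT-4 hypotheses verbatim) and `α ≤ α₀`, with the SLOPES and FLOORS at `α₀` bound by definitional
equalities — `s_D = √d·2M_φM_φ′`, `s_Q = 2·d(L−1)·2M_φM_φ′∕(1−r)`, `θ̄ = s_Qα₀`, `γ_m = 1∕(2+2∕a′) − (s_Dα₀ + (s_Dα₀)² + a′θ̄(2 + θ̄))`,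
`s_G = 2s_D·γ_m⁻¹(√γ_m)⁻¹ + |a′|s_Q(2 + θ̄)γ_m⁻²`, `s_A = s_G(1 + θ̄) + (2+2∕a′)s_Q`, `s♯ = √((12d(6∕5)^{d−1} + a′)^{−2})` — in the window
`d(L−1)·2M_φM_φ′·α₀∕(1−r) ≤ 1`, `0 < γ_m`, `2s_Aα₀ ≤ s♯`:  **`‖R_k(U)f − R_k(1)f‖ ≤ (3s_A∕s♯)·α·‖f‖`** — `C_R := 3s_A∕s♯` a CLOSED function of
`(d, a′, M_φM_φ′, L, r, α₀)`: NO `η`, NO volume, NO number of levels (as print's constants: `L`-dependent, `k`-free). `B9Eq325RLipschitzSqrtTowerDiagonal` §3 + monotonicity of every letter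
in `(δ_D, θ_Q)` + `δ∕(s−δ) + δ∕s ≤ 3δ∕s` on `2δ ≤ s`. [cite: Balaban1985BackgroundPropagators, p.403, (3.25) p.394, (3.35)–(3.37) p.396, Thm 3.11 p.416] -/
theorem norm_RofUk_sub_RofUk_one_le_diagonal_linear (εU : ℕ → ℝ) (hεU : ∀ j, 0 ≤ εU j)
    (hLε : ∀ (j : ℕ) (b : Bond d (towerP L m (j + 1))), ‖(UlevOf L m (n + 1) U j b : 𝔸) - 1‖ ≤ εU j)
    (hLb : ∀ (j : ℕ) (b : Bond d (towerP L m (j + 1))), UlevOf L m (n + 1) U j b ∈ U1 𝔸)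
    {r α₀ : ℝ} (hr0 : 0 ≤ r) (hr1 : r < 1) (hαα₀ : α ≤ α₀) (hεg : ∀ j < n + 1, εU j ≤ α * r ^ j)
    {sD sQ θb γm sG sA sS : ℝ}
    (hsD : sD = Real.sqrt d * (2 * Mφ * Mφ'))
    (hsQ : sQ = 2 * (((d * (L - 1) : ℕ) : ℝ) * (2 * Mφ * Mφ') / (1 - r)))
    (hθb : θb = sQ * α₀)
    (hγm : γm = 1 / (2 + 2 / a') - (sD * α₀ + (sD * α₀) ^ 2 + a' * θb * (2 * 1 + θb)))
    (hsG : sG = 2 * sD * (γm⁻¹ * (Real.sqrt γm)⁻¹) + (|a'| * sQ * ((1 + θb) + 1)) * γm⁻¹ ^ 2)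
    (hsA : sA = sG * (1 + θb) + (2 + 2 / a') * sQ)
    (hsS : sS = Real.sqrt (1 / (12 * (d : ℝ) * (6 / 5) ^ (d - 1) + a') ^ 2))
    (hc1 : ((d * (L - 1) : ℕ) : ℝ) * (2 * Mφ * Mφ') / (1 - r) * α₀ ≤ 1) (hγm0 : 0 < γm) (hwin : 2 * sA * α₀ ≤ sS)
    (f : SiteL2K ℂ d (towerP L m (n + 1)) c₀ W) :
    ‖RofUk L m n φ η U (c₀ := c₀) f - RofUk L m n φ η (fun _ : Bond d (towerP L m (n + 1)) => (1 : 𝔸ˣ)) (c₀ := c₀) f‖ ≤ (3 * sA / sS) * α * ‖f‖ := by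
  have hK : 0 ≤ 2 * Mφ * Mφ' := by positivity
  have hα₀ : 0 ≤ α₀ := hα.trans hαα₀
  have h1r : 0 < 1 - r := by linarith
  have hsS0 : 0 < sS := by rw [hsS]; positivity
  -- the exact letters of `B9Eq325RLipschitzSqrtTowerDiagonal` §3
  obtain ⟨θQ, hθQdef⟩ : ∃ θQ : ℝ, θQ = (∏ j ∈ Finset.range (n + 1), (1 + 2 * Mφ * Mφ' * εU j) ^ (d * (L - 1))) - 1 := ⟨_, rfl⟩
  obtain ⟨δD, hδDdef⟩ : ∃ δD : ℝ, δD = Real.sqrt d * (2 * Mφ * Mφ') * α := ⟨_, rfl⟩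
  obtain ⟨γU, hγUdef⟩ : ∃ γU : ℝ, γU = 1 / (2 + 2 / a') - (δD + δD ^ 2 + a' * θQ * (2 * 1 + θQ)) := ⟨_, rfl⟩
  obtain ⟨θG, hθGdef⟩ : ∃ θG : ℝ, θG = 2 * δD * (γU⁻¹ * (Real.sqrt γU)⁻¹) + (|a'| * θQ * ((1 + θQ) + 1)) * γU⁻¹ ^ 2 := ⟨_, rfl⟩
  -- `θ_Q ≤ s_Q·α ≤ θ̄`, `0 ≤ θ_Q`
  have hθQ0 : 0 ≤ θQ := by
    rw [hθQdef]
    exact sub_nonneg.2 (Finset.one_le_prod (s := Finset.range (n + 1)) fun j _ => one_le_pow₀ (by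
      have h0 : 0 ≤ 2 * Mφ * Mφ' * εU j := by have := hεU j; positivity
      linarith))
  have hc1α : ((d * (L - 1) : ℕ) : ℝ) * (2 * Mφ * Mφ') / (1 - r) * α ≤ 1 :=
    (mul_le_mul_of_nonneg_left hαα₀ (by positivity)).trans hc1
  have hθQle : θQ ≤ sQ * α := by
    rw [hθQdef, hsQ]
    have h := prod_profile_sub_one_le_linear L n hK hr0 hr1 hα εU hεU hεg hc1α
    linarith [h]
  have hsQ0 : 0 ≤ sQ := by rw [hsQ]; positivity
  have hθQb : θQ ≤ θb := by rw [hθb]; exact hθQle.trans (mul_le_mul_of_nonneg_left hαα₀ hsQ0)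
  have hθb0 : 0 ≤ θb := hθQ0.trans hθQb
  -- `δ_D = s_D·α ≤ s_D·α₀`
  have hsD0 : 0 ≤ sD := by rw [hsD]; positivity
  have hδDeq : δD = sD * α := by rw [hδDdef, hsD]
  have hδD0 : 0 ≤ δD := by rw [hδDeq]; positivity
  have hδDb : δD ≤ sD * α₀ := by rw [hδDeq]; exact mul_le_mul_of_nonneg_left hαα₀ hsD0
  -- `γ_U ≥ γ_m > 0`
  have hγUge : γm ≤ γU := by
    rw [hγm, hγUdef]
    have h1 : δD ^ 2 ≤ (sD * α₀) ^ 2 := pow_le_pow_left₀ hδD0 hδDb 2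
    have h2 : a' * θQ * (2 * 1 + θQ) ≤ a' * θb * (2 * 1 + θb) := by
      have : θQ * (2 * 1 + θQ) ≤ θb * (2 * 1 + θb) := mul_le_mul hθQb (by linarith) (by positivity) hθb0
      rw [mul_assoc, mul_assoc]
      exact mul_le_mul_of_nonneg_left this ha'.le
    linarith
  have hγU0 : 0 < γU := hγm0.trans_le hγUge
  have hDγ : δD ≤ 1 / (2 + 2 / a') := by
    have : 0 ≤ (sD * α₀) ^ 2 + a' * θb * (2 * 1 + θb) := by positivity
    rw [hγm] at hγm0
    linarith
  -- `θ_G ≤ s_G·α`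
  have hinv1 : γU⁻¹ ≤ γm⁻¹ := inv_anti₀ hγm0 hγUge
  have hinv2 : (Real.sqrt γU)⁻¹ ≤ (Real.sqrt γm)⁻¹ := inv_anti₀ (Real.sqrt_pos.2 hγm0) (Real.sqrt_le_sqrt hγUge)
  have hinv10 : 0 ≤ γU⁻¹ := by positivity
  have hinv20 : 0 ≤ (Real.sqrt γU)⁻¹ := by positivity
  have hθGle : θG ≤ sG * α := by
    rw [hθGdef, hsG]
    have hA : 2 * δD * (γU⁻¹ * (Real.sqrt γU)⁻¹) ≤ 2 * sD * (γm⁻¹ * (Real.sqrt γm)⁻¹) * α := by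
      rw [hδDeq]
      have : γU⁻¹ * (Real.sqrt γU)⁻¹ ≤ γm⁻¹ * (Real.sqrt γm)⁻¹ := mul_le_mul hinv1 hinv2 hinv20 (by positivity)
      calc 2 * (sD * α) * (γU⁻¹ * (Real.sqrt γU)⁻¹) ≤ 2 * (sD * α) * (γm⁻¹ * (Real.sqrt γm)⁻¹) :=
            mul_le_mul_of_nonneg_left this (by positivity)
        _ = 2 * sD * (γm⁻¹ * (Real.sqrt γm)⁻¹) * α := by ring
    have hB : |a'| * θQ * ((1 + θQ) + 1) * γU⁻¹ ^ 2 ≤ |a'| * sQ * ((1 + θb) + 1) * γm⁻¹ ^ 2 * α := by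
      have h1 : θQ * ((1 + θQ) + 1) ≤ sQ * α * ((1 + θb) + 1) := mul_le_mul hθQle (by linarith) (by positivity) (by positivity)
      have h2 : γU⁻¹ ^ 2 ≤ γm⁻¹ ^ 2 := pow_le_pow_left₀ hinv10 hinv1 2
      calc |a'| * θQ * ((1 + θQ) + 1) * γU⁻¹ ^ 2 = |a'| * (θQ * ((1 + θQ) + 1)) * γU⁻¹ ^ 2 := by ring
        _ ≤ |a'| * (sQ * α * ((1 + θb) + 1)) * γm⁻¹ ^ 2 := by gcongr
        _ = |a'| * sQ * ((1 + θb) + 1) * γm⁻¹ ^ 2 * α := by ring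
    linarith
  have hsG0 : 0 ≤ sG := by rw [hsG]; positivity
  have hθG0 : 0 ≤ θG := by rw [hθGdef]; positivity
  -- `δ_A ≤ s_A·α ≤ s♯∕2`
  have hδAle : θG * (1 + θQ) + (2 + 2 / a') * θQ ≤ sA * α := by
    rw [hsA]
    have h1 : θG * (1 + θQ) ≤ sG * α * (1 + θb) := mul_le_mul hθGle (by linarith) (by positivity) (by positivity)
    have h2 : (2 + 2 / a') * θQ ≤ (2 + 2 / a') * (sQ * α) := mul_le_mul_of_nonneg_left hθQle (by positivity)
    linarith
  have hsA0 : 0 ≤ sA := by rw [hsA]; positivity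
  have hδA0 : 0 ≤ θG * (1 + θQ) + (2 + 2 / a') * θQ := by positivity
  have hδAhalf : 2 * (θG * (1 + θQ) + (2 + 2 / a') * θQ) ≤ sS := by
    have : sA * α ≤ sA * α₀ := mul_le_mul_of_nonneg_left hαα₀ hsA0
    linarith
  have hwin' : θG * (1 + θQ) + (2 + 2 / a') * θQ < Real.sqrt (1 / (12 * (d : ℝ) * (6 / 5) ^ (d - 1) + a') ^ 2) := by
    rw [← hsS]; linarith
  -- `…Diagonal` §3, then `δ∕(s−δ) + δ∕s ≤ 3δ∕s ≤ (3s_A∕s♯)·α`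
  have hmain := norm_RofUk_sub_RofUk_one_le_diagonal L m n φ hMφ hMφ' hφ hφ' c₀ η c₁ ha' hηL hw U hRS hα hUb hUε εU hεU hLε hLb hθQdef hδDdef
    hγUdef hθGdef hγU0 hDγ hwin' f
  rw [← hsS] at hmain
  set δA : ℝ := θG * (1 + θQ) + (2 + 2 / a') * θQ with hδA
  have hthree : δA / (sS - δA) + δA / sS ≤ 3 * δA / sS := by
    have h1 : δA / (sS - δA) ≤ δA / (sS / 2) := div_le_div_of_nonneg_left hδA0 (by positivity) (by linarith)
    rw [div_div_eq_mul_div] at h1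
    have e : 3 * δA / sS = δA * 2 / sS + δA / sS := by ring
    rw [e]
    linarith
  have hlin : 3 * δA / sS ≤ 3 * sA / sS * α := by
    rw [mul_div_assoc, mul_div_assoc, mul_assoc]
    refine mul_le_mul_of_nonneg_left ?_ (by norm_num)
    rw [div_mul_eq_mul_div]
    exact div_le_div_of_nonneg_right hδAle hsS0.le
  exact hmain.trans (mul_le_mul_of_nonneg_right (hthree.trans hlin) (norm_nonneg _))

end Literature.MathematicalPhysics.QuantumFieldTheory.Balaban1983to89.B9Eq325RLipschitzSqrtTowerLinear

end
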